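import Summits.CriticalPhenomena.SAWScalingLimit.Theorems.SAWLoopFugacityFlowSimpleSubseqLimitsSlitLine
import Summits.CriticalPhenomena.SAWScalingLimit.Theses.SAWStressTensor
import HarnessLib

/-!
# Birth skeleton of the ORDER child `SeqSlitAvoidance` (stmt-CriticalPhenomena-18169) of the split of the
# crux `SimpleSubseqLimits` (stmt-CriticalPhenomena-4982 on SAWLoopFugacityFlow, rev 4; stmt-CriticalPhenomena-4514
# on the observable routes, ARC split by crux strategist session B, 2026-08-17)

The child decl `Summit.CriticalPhenomena.SAWScalingLimit.Theses.SAWLoopFugacityFlow.SeqSlitAvoidance` IS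
`SlitRestriction.Transfer.SequentialSlitAvoidance` (`child_iff`, `Iff.rfl`): conditional first-entrance
far-slit avoidance of the critical `δℤ²` SAW, sequentially continuous in the admissible limit past. This file
is the child's OWN registered skeleton ("a plan for both sides", BC2-redirect clause (d)): it is the crux
strategist s2's ALT line `slit-collar-avoidance` (`Cruxes/SimpleSubseqLimits/Lines/slit_collar_avoidance.lean`,
kernel-checked there against the PARENT) re-targeted at the CHILD BY NAME — vocabulary and the six stubs
VERBATIM (credit: planner-cstrat-stmt-CriticalPhenomena-4982-s2-0), compositions new.

## The line in one paragraph (s2)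

`SlitCollarAvoidance` (SCA, OPEN, the one research input): the critical SAW of ANY sequence of open lattice
sub-domains `V n ⊆ Ω` converging to a slit domain `(Ω ∖ e[0,1]; e m, b)` in the ψ-FREE rooted kernel sense
(Carathéodory K1/K2 + access paths at both roots; no uniformiser, no restriction map, no exponent) avoids an
`ε`-collar of the far sub-arc `e[0,s₀]` (`s₀ < m`) with probability `≥ 1 − θ`, eventually — boundary-collar
repulsion continuous in the rooted kernel topology, the output shape of every lattice → SLE engine in print
(Chelkak–Smirnov compactness; LSW04 LERW uniformly over grid domains), minus the values. `PuncturedMarkov`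
(exact domain Markov of `x_c^{|γ|}` in punctured convention, general Dobrushin domain) and the lattice /
point-set bridge `stub_collarBridge : PuncturedMarkov → SlitCollarAvoidance → SequentialSlitAvoidance` carry
SCA to the child with NO conformal map. The VALUE path (`stub_collarOfValues : SlitUniformizer →
FarHullVanishAt → RootedAvoidanceLimit → SCA`, with the strategist p1's C⁺ `RootedAvoidanceLimit` VERBATIM)
records how progress on stmt-10649's domain-continuous form lands here mechanically.

## Registered stubs (6; sorries ONLY here): see `slit_collar_avoidance.lean` for sizes and the Disproof ledger
1. `stub_slitCollarAvoidance` — OPEN (research; hardest; strictly between the child and p1's value package;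
   not summit-implied, not child-equivalent: arbitrary kernel-convergent sub-domains, not only punctured
   prefix domains). 2. `stub_puncturedMarkov` — M. 3. `stub_collarBridge` — M–L. 4. `stub_farHullVanishAt` —
   M–L. 5. `stub_slitUniformizer` — L, classical. 6. `stub_collarOfValues` — M.
-/

noncomputable section

open MeasureTheory Filter Topology Set Metric Function
open Literature.Probability.RandomPlanarGeometry Literature.Probability.RandomPlanarGeometry.SAW
open Literature.Probability.LatticeModels
open UpperHalfPlane (upperHalfPlaneSet)
open scoped ENNReal NNReal BoundedContinuousFunction unitInterval

namespace Summit.CriticalPhenomena.SAWScalingLimit.Cruxes.SimpleSubseqLimits.SeqSlitBirth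

open Summit.CriticalPhenomena.SAWScalingLimit.Theorems.SimpleSubseqLimits.SlitRestriction.Lattice
  (prefixEvent approachEvent law_univ_le_one)
open Summit.CriticalPhenomena.SAWScalingLimit.Theorems.SimpleSubseqLimits.SlitRestriction.Transfer
  (SequentialSlitAvoidance)
open Summit.CriticalPhenomena.SAWScalingLimit.Theorems.SimpleSubseqLimits.SlitRestriction.Line
  (line_slitContinuousRestriction)

/-! ## Vocabulary, lattice side -/

section Lattice

variable {Ω : Set ℂ} {δ : ℝ} {u t : Site 2}

/-- The **remaining vertex set** of a prefix `ω : u → t` in `Ω_δ`: the vertices joined to the tip `t` by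
a walk of `Ω_δ` avoiding the prefix's earlier vertices (the tip's component; dead pockets cut off by
the prefix and the smaller components of the mesh graph are discarded — the general-domain analogue of
`CapacityClock.DomainMarkov.remainingVerts`). [folklore] -/
def remaining (ω : SAW.DomainSAW Ω δ u t) : Set (Site 2) :=
  {w | ∃ p : (discreteDomainGraph Ω δ).Walk t w, ∀ x ∈ p.support, x ∉ ω.walk.support.dropLast}

/-- The **punctured slit domain** of a prefix: `Ω` minus the closed `δ/3`-discs at every mesh vertex of
`Ω` outside the remaining set. It is open, its mesh vertices are exactly the remaining vertices, mesh
edges between remaining vertices survive (a mesh vertex is at distance `≥ δ` from every mesh edge not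
containing it), and its discrete domain is the tip component — so the critical SAW law of this domain
from `t` is the conditional law of the future (`PuncturedMarkov`). [folklore] -/
def puncturedDomain (ω : SAW.DomainSAW Ω δ u t) : Set ℂ :=
  Ω \ ⋃ x ∈ meshVertices Ω δ \ remaining ω, closedBall (meshPoint δ x) (δ / 3)

/-- The **collar event** of a walk from `t`: some vertex (the root `t` included) is `ε`-close to a point
of `F`. [folklore] -/
def collarEvent {v : Site 2} (F : Set ℂ) (ε : ℝ) : Set (SAW.DomainSAW Ω δ t v) :=
  {γ | ∃ j : ℕ, j ≤ γ.length ∧ ∃ z ∈ F, dist (meshPoint δ (γ.walk.getVert j)) z < ε}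

end Lattice

/-- **PUNCTURED MARKOV** — the exact domain Markov property of the critical SAW law of a GENERAL
Dobrushin domain in punctured convention: for a prefix `ω : u → t` of `Ω_δ`, a set `F` and a width
`ε`, the law of {prefix `= ω`, some later vertex `ε`-close to `F`} (`Lattice.approachEvent`) equals the
law of the prefix event times the critical SAW law of the punctured slit domain from the tip `t` of the
collar event (the `x_c`-weights factorise along the glue bijection; degenerate data make both sides
`0`; no positivity of `x_c` is needed). Route-local statement (untagged); classical content
Madras–Slade §1.2, LSW04 §3.4.5, Kemppainen–Smirnov §4.1.6. -/
def PuncturedMarkov : Prop :=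
  ∀ (D : DobrushinDomain) (δ : ℝ) (u t v : Site 2) (ω : SAW.DomainSAW D.carrier δ u t)
    (F : Set ℂ) (ε : ℝ), 0 < δ →
    SAW.law D.carrier δ u v (approachEvent (v := v) ω F ε) =
      SAW.law D.carrier δ u v (prefixEvent (v := v) ω) *
        SAW.law (puncturedDomain ω) δ t v (collarEvent F ε)

/-! ## Vocabulary, slit-domain side -/

/-- A **slit arc** of the Dobrushin domain `D`: an injective arc from the root `a = D.pt 0` with range in
`cl D` meeting `∂D` only at the root (so `D ∖ e[0,1]` is a simply connected slit domain and `b ∉ e[0,1]`).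
Exactly the range data of `Arc.IsAdmissiblePast`. [folklore] -/
def IsSlitArc (D : DobrushinDomain) (e : C(I, ℂ)) : Prop :=
  Injective e ∧ e 0 = D.pt 0 ∧ range e ⊆ closure D.carrier ∧
    ∀ u : I, e u ∈ frontier D.carrier → u = 0

/-- **ψ-free rooted kernel convergence** of the lattice domains `(V n; t n, b n)` at meshes `δ n` to the
rooted slit domain `(D ∖ e[0,1]; e m, b)`: open sub-domains of `D` in which the lattice roots are joined;
meshes `→ 0⁺`; Carathéodory (K1) every compact of the slit domain is eventually inside, (K2) no disc about
a point outside the slit domain is eventually inside; and ACCESS PATHS from the two lattice roots inside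
`V n`, converging uniformly to paths that enter the slit domain at once from `e m`, resp. from `b`
(this excludes roots trapped in vanishing corridors; it does NOT name a prime end — the collar bound
below holds for either side of a two-sided root). p1's `RootedKernelLimit` minus the uniformiser.
[folklore] -/
def SlitKernelData (D : DobrushinDomain) (e : C(I, ℂ)) (m : I)
    (V : ℕ → Set ℂ) (δ : ℕ → ℝ) (t b : ℕ → Site 2) : Prop :=
  (∀ n, IsOpen (V n)) ∧ (∀ n, V n ⊆ D.carrier) ∧
  (∀ n, (discreteDomainGraph (V n) (δ n)).Reachable (t n) (b n)) ∧
  Tendsto δ atTop (𝓝[>] (0 : ℝ)) ∧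
  (∀ C : Set ℂ, IsCompact C → C ⊆ D.carrier \ range e → ∀ᶠ n in atTop, C ⊆ V n) ∧
  (∀ p : ℂ, p ∉ D.carrier \ range e → ∀ r : ℝ, 0 < r → ∀ᶠ n in atTop, ¬ (ball p r ⊆ V n)) ∧
  (∃ (c : ℕ → C(I, ℂ)) (cLim : C(I, ℂ)), (∀ n, c n 0 = meshPoint (δ n) (t n)) ∧
    (∀ n, range (c n) ⊆ V n) ∧ TendstoUniformly (fun n => ⇑(c n)) cLim atTop ∧ cLim 0 = e m ∧
    ∀ s : I, 0 < s → cLim s ∈ D.carrier \ range e) ∧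
  (∃ (c : ℕ → C(I, ℂ)) (cLim : C(I, ℂ)), (∀ n, c n 0 = meshPoint (δ n) (b n)) ∧
    (∀ n, range (c n) ⊆ V n) ∧ TendstoUniformly (fun n => ⇑(c n)) cLim atTop ∧ cLim 0 = D.pt 1 ∧
    ∀ s : I, 0 < s → cLim s ∈ D.carrier \ range e)

/-- **SLIT COLLAR AVOIDANCE** (SCA) — the line's OPEN input, the A-side made continuous along slit
domains in its weakest, value-free and map-free form. For every Dobrushin domain, slit arc `e`,
parameters `s₀ < m` (root `e m`, far sub-arc `e[0, s₀]`), and every sequence of rooted lattice domains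
converging to `(D ∖ e[0,1]; e m, b)` in the ψ-free rooted kernel sense, and every `θ > 0`, there is a
width `ε > 0` such that eventually the critical SAW of `V n` from `t n` to `b n` has a vertex `ε`-close
to the far sub-arc with probability at most `θ`. Implied by p1's value package (`stub_collarOfValues`);
implies the live stub (`stub_collarBridge`). Deliberately untagged: not a literature fact; research-open;
not implied by the summit as typed (diagonal domain sequences). -/
def SlitCollarAvoidance : Prop :=
  ∀ (D : DobrushinDomain) (e : C(I, ℂ)) (s₀ m : I), IsSlitArc D e → s₀ < m →
    ∀ (V : ℕ → Set ℂ) (δ : ℕ → ℝ) (t b : ℕ → Site 2), SlitKernelData D e m V δ t b →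
      ∀ θ : ℝ, 0 < θ → ∃ ε : ℝ, 0 < ε ∧ ∀ᶠ n in atTop,
        SAW.law (V n) (δ n) (t n) (b n) (collarEvent (e '' Icc 0 s₀) ε) ≤ ENNReal.ofReal θ

/-- Sanity (the statement computes; targets `θ ≥ 1` are free): the collar bound holds trivially for
`1 ≤ θ`, because `SAW.law` has total mass `≤ 1` (`Lattice.law_univ_le_one`). [folklore] -/
theorem collar_le_of_one_le {Ω : Set ℂ} {δ : ℝ} {t v : Site 2} (F : Set ℂ) (ε : ℝ) {θ : ℝ}
    (hθ : 1 ≤ θ) : SAW.law Ω δ t v (collarEvent F ε) ≤ ENNReal.ofReal θ :=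
  (measure_mono (subset_univ _)).trans (law_univ_le_one.trans (ENNReal.one_le_ofReal.2 hθ))

/-! ## Vocabulary, value side (p1's C⁺ verbatim; far hulls at a side root; adapted uniformisers) -/

/-- **Rooted kernel convergence** (VERBATIM copy of `RootedRestrictionValues.RootedKernelLimit`, the
strategist p1's line `Lines/rooted_restriction_values.lean`): ψ-free data as above PLUS the pinning of
the two roots to the prime ends `0`, `∞` of the uniformiser `ψ`. [folklore] -/
def RootedKernelLimit (D : DobrushinDomain) (K : Set ℂ)
    (ψ : ConformalEquiv upperHalfPlaneSet (D.carrier \ K)) (tLim : ℂ)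
    (V : ℕ → Set ℂ) (δ : ℕ → ℝ) (t b : ℕ → Site 2) : Prop :=
  (∀ n, IsOpen (V n)) ∧ (∀ n, V n ⊆ D.carrier) ∧
  (∀ n, (discreteDomainGraph (V n) (δ n)).Reachable (t n) (b n)) ∧
  (∀ C : Set ℂ, IsCompact C → C ⊆ D.carrier \ K → ∀ᶠ n in atTop, C ⊆ V n) ∧
  (∀ p : ℂ, p ∉ D.carrier \ K → ∀ r : ℝ, 0 < r → ∀ᶠ n in atTop, ¬ (ball p r ⊆ V n)) ∧
  (∃ (c : ℕ → C(I, ℂ)) (cLim : C(I, ℂ)), (∀ n, c n 0 = meshPoint (δ n) (t n)) ∧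
    (∀ n, range (c n) ⊆ V n) ∧ TendstoUniformly (fun n => ⇑(c n)) cLim atTop ∧ cLim 0 = tLim ∧
    (∀ s : I, 0 < s → cLim s ∈ D.carrier \ K) ∧
    Tendsto (fun s : I => ψ.symm (cLim s)) (𝓝[>] 0) (𝓝 0)) ∧
  (∃ (e : ℕ → C(I, ℂ)) (eLim : C(I, ℂ)), (∀ n, e n 0 = meshPoint (δ n) (b n)) ∧
    (∀ n, range (e n) ⊆ V n) ∧ TendstoUniformly (fun n => ⇑(e n)) eLim atTop ∧ eLim 0 = D.pt 1 ∧
    (∀ s : I, 0 < s → eLim s ∈ D.carrier \ K) ∧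
    Tendsto (fun s : I => ‖ψ.symm (eLim s)‖) (𝓝[>] 0) atTop)

/-- **C⁺ — ROOTED AVOIDANCE LIMIT** (VERBATIM copy of `RootedRestrictionValues.RootedAvoidanceLimit`,
p1's open input; reproduced so that ONE research object serves both strategist lines and stmt-10649).
Deliberately untagged (not a literature fact). -/
def RootedAvoidanceLimit : Prop :=
  ∀ (D : DobrushinDomain) (K : Set ℂ) (ψ : ConformalEquiv upperHalfPlaneSet (D.carrier \ K)) (tLim : ℂ)
    (V : ℕ → Set ℂ) (δ : ℕ → ℝ) (t b : ℕ → Site 2),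
    IsCompact K → ψ.HasBoundaryValue 0 tLim → ψ.HasBoundaryValueAtInfty (D.pt 1) →
    Tendsto δ atTop (𝓝[>] (0 : ℝ)) → RootedKernelLimit D K ψ tLim V δ t b →
    ∀ (O : Set ℂ), IsOpen O → tLim ∉ closure O → D.pt 1 ∉ closure O →
    ∀ (A : Set ℂ), A = closure (upperHalfPlaneSet \
        {z | z ∈ upperHalfPlaneSet ∧ ψ z ∈ (D.carrier \ K) \ closure O}) →
    ∀ (Φ : ConformalEquiv (upperHalfPlaneSet \ A) upperHalfPlaneSet) (d : ℝ),
      IsRestrictionMap A Φ → HasRestrictionDeriv A Φ d →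
      Tendsto (fun n => ((SAW.law (V n) (δ n) (t n) (b n)).map (fun γ => γ.curve))
          (CurveClass.rangeSubset Oᶜ)) atTop (𝓝 (ENNReal.ofReal (d ^ ((5 : ℝ) / 8))))

/-- **FAR HULLS VANISH AT A SIDE ROOT** (deterministic): slit the Jordan domain by a slit arc `e`, root
the slit domain at the point `e m` (either prime end over it when `m < 1`; the arc end when `m = 1`) and
at `b`, and let `F = e[0, s₀]`, `s₀ < m`, be a far sub-arc. For every `η > 0` there are a width `ε > 0`
and an open `O ⊇ (ε-thickening of F)` with closure missing `e m` and `b`, whose pulled-back hull carries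
a restriction map with derivative `d > 1 - η`. p1's `FarHullVanish` is the case `m = 1`; the side-rooted
case is needed because `SequentialSlitAvoidance` / `SlitCollarAvoidance` quantify over folded pasts
(tip an interior point of the range arc). Route-local (untagged); classical content LSW03 §2–3,
Pommerenke Thm 2.1/2.6. -/
def FarHullVanishAt : Prop :=
  ∀ (D : DobrushinDomain) (e : C(I, ℂ)) (s₀ m : I)
    (ψ : ConformalEquiv upperHalfPlaneSet (D.carrier \ range e)),
    IsSlitArc D e → s₀ < m → ψ.HasBoundaryValue 0 (e m) → ψ.HasBoundaryValueAtInfty (D.pt 1) →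
    ∀ η : ℝ, 0 < η → ∃ ε : ℝ, 0 < ε ∧ ∃ O : Set ℂ, IsOpen O ∧ thickening ε (e '' Icc 0 s₀) ⊆ O ∧
      e m ∉ closure O ∧ D.pt 1 ∉ closure O ∧
      ∀ (A : Set ℂ), A = closure (upperHalfPlaneSet \
          {z | z ∈ upperHalfPlaneSet ∧ ψ z ∈ (D.carrier \ range e) \ closure O}) →
        ∃ (Φ : ConformalEquiv (upperHalfPlaneSet \ A) upperHalfPlaneSet) (d : ℝ),
          IsRestrictionMap A Φ ∧ HasRestrictionDeriv A Φ d ∧ 1 - η < d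

/-- **SLIT UNIFORMISERS ADAPTED TO AN ACCESS PATH** (classical): for a slit arc `e` of `D`, a root
`e m` (`0 < m`) and an access path `c` entering the slit domain from `e m`, there is a chordal
uniformiser `ψ : ℍ → D ∖ e[0,1]` with boundary value `e m` at `0` and `b` at `∞`, along which `c`
enters through `0` (`ψ⁻¹ ∘ c → 0`) and EVERY access path at `b` leaves through `∞`. Riemann mapping
(PROVED in tree, `exists_conformalEquiv_upperHalfPlaneSet_holds`) + Carathéodory–Torhorst continuity of
the extension at the locally connected boundary `∂D ∪ e[0,1]` + connectedness of cluster sets of paths +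
a Möbius normalisation. Route-local (untagged); Pommerenke (1992) Thm 2.1, §2.4. -/
def SlitUniformizer : Prop :=
  ∀ (D : DobrushinDomain) (e : C(I, ℂ)) (m : I), IsSlitArc D e → 0 < m →
    ∀ (c : C(I, ℂ)), c 0 = e m → (∀ s : I, 0 < s → c s ∈ D.carrier \ range e) →
      ∃ ψ : ConformalEquiv upperHalfPlaneSet (D.carrier \ range e),
        ψ.HasBoundaryValue 0 (e m) ∧ ψ.HasBoundaryValueAtInfty (D.pt 1) ∧
        Tendsto (fun s : I => ψ.symm (c s)) (𝓝[>] 0) (𝓝 0) ∧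
        ∀ (c' : C(I, ℂ)), c' 0 = D.pt 1 → (∀ s : I, 0 < s → c' s ∈ D.carrier \ range e) →
          Tendsto (fun s : I => ‖ψ.symm (c' s)‖) (𝓝[>] 0) atTop

/-! ## Registered stubs -/

/-- STUB 1 — THE INPUT (open; hardest): slit collar avoidance. -/
theorem stub_slitCollarAvoidance : SlitCollarAvoidance := by
  sorry

/-- STUB 2 — the exact domain Markov property in punctured convention, general Dobrushin domain. -/
theorem stub_puncturedMarkov : PuncturedMarkov := by
  sorry

/-- STUB 3 — THE LATTICE BRIDGE: punctured prefix domains of first-entrance prefixes converging to an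
admissible past satisfy the ψ-free rooted kernel hypotheses (tip `π 1 = e m` with `s₀ < m` and
`farPast π q R ⊆ e '' Icc 0 s₀` by the first-entrance structure: all earlier values of `π` lie outside
the OPEN entrance ball, the far past outside `B(q, R)`; fat pockets of the punctured graph die, thin ones
hug the arc; tip access along the free radial segment into `B(q, ρ)`; target access by the proved
Carathéodory extension at `b`; indices with empty prefix event are trivial `0 ≤ 0`), `PuncturedMarkov`
converts the collar bound of the future into the cross-multiplied prefix bound (tip excluded from the
collar for `ε < (R - ρ)/2`), and the `∀ sequence ∃ ε` form is upgraded to `∃ ε ∀ sequences` by the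
diagonal argument of `Transfer.locallyUniform_of_sequential` (violations at widths `1/k` merge into one
admissible sequence; `approachEvent` is monotone in `ε`). -/
theorem stub_collarBridge : PuncturedMarkov → SlitCollarAvoidance → SequentialSlitAvoidance := by
  sorry

/-- STUB 4 — far hulls vanish at a side root (deterministic conformal geometry). -/
theorem stub_farHullVanishAt : FarHullVanishAt := by
  sorry

/-- STUB 5 — slit uniformisers adapted to an access path (classical complex analysis). -/
theorem stub_slitUniformizer : SlitUniformizer := by
  sorry

/-- STUB 6 — THE VALUE PATH: p1's C⁺ with far hulls vanishing gives slit collar avoidance. Given the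
ψ-free data of SCA, `SlitUniformizer` (applied to the tip access path) supplies `ψ` with the two boundary
values, `ψ⁻¹ ∘ cLim → 0` and `‖ψ⁻¹ ∘ eLim‖ → ∞`, i.e. p1's `RootedKernelLimit`; `FarHullVanishAt` with
`η ≤ θ/2` supplies `ε`, `O ⊇ thickening ε (e '' Icc 0 s₀)` and restriction data with `d > 1 - η`; C⁺
gives `P_n[range ⊆ Oᶜ] → d^{5/8} ≥ 1 - η`; a vertex `ε`-close to the far sub-arc lies in `O` and on the
polyline, so `collarEvent ⊆ {curve ∉ rangeSubset Oᶜ}`, whose law is `1 - P_n[range ⊆ Oᶜ]` (the laws are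
probability measures by `Reachable`, Disproof `isProbabilityMeasure_law_of_reachable`), eventually `≤ θ`. -/
theorem stub_collarOfValues :
    SlitUniformizer → FarHullVanishAt → RootedAvoidanceLimit → SlitCollarAvoidance := by
  sorry

/-! ## Name-keyed aliases (the skeleton audit admits a hypothesis of the composition only if its head constant
is a registered obligation or is named like a declared stub; same device as `Lines/birth.lean`) -/
namespace Registered

/-- Alias of `SlitCollarAvoidance` keyed by the registered stub name. -/
abbrev stub_slitCollarAvoidance : Prop := SlitCollarAvoidance
/-- Alias of `PuncturedMarkov` keyed by the registered stub name. -/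
abbrev stub_puncturedMarkov : Prop := PuncturedMarkov
/-- Alias of the bridge statement keyed by the registered stub name. -/
abbrev stub_collarBridge : Prop := PuncturedMarkov → SlitCollarAvoidance → SequentialSlitAvoidance
/-- Alias keyed by the registered stub name. -/
abbrev stub_farHullVanishAt : Prop := FarHullVanishAt
/-- Alias keyed by the registered stub name. -/
abbrev stub_slitUniformizer : Prop := SlitUniformizer
/-- Alias of the value-path statement keyed by the registered stub name. -/
abbrev stub_collarOfValues : Prop := SlitUniformizer → FarHullVanishAt → RootedAvoidanceLimit → SlitCollarAvoidance

end Registered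

/-! ## Compositions (kernel-checked): the stubs conclude the CHILD BY NAME -/

/-- The child decl of route SAWLoopFugacityFlow (item stmt-CriticalPhenomena-18169) IS
`Transfer.SequentialSlitAvoidance` (definitional). [folklore] -/
theorem child_iff :
    Summit.CriticalPhenomena.SAWScalingLimit.Theses.SAWLoopFugacityFlow.SeqSlitAvoidance ↔
      SequentialSlitAvoidance :=
  Iff.rfl

/-- **COMPOSITION (value-free path).** `stub_slitCollarAvoidance → stub_puncturedMarkov → stub_collarBridge →`
the child `SAWLoopFugacityFlow.SeqSlitAvoidance` BY NAME. [folklore] -/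
theorem SeqSlitAvoidance_of (h1 : Registered.stub_slitCollarAvoidance) (h2 : Registered.stub_puncturedMarkov)
    (h3 : Registered.stub_collarBridge) :
    Summit.CriticalPhenomena.SAWScalingLimit.Theses.SAWLoopFugacityFlow.SeqSlitAvoidance :=
  child_iff.2 (h3 h2 h1)

/-- **COMPOSITION (value path).** p1's C⁺ (`RootedAvoidanceLimit`, hypothesis — the open stub of the
sibling line `rooted-restriction-values` of the parent) with stubs 4, 5, 6, 2, 3 concludes the child BY
NAME. [folklore] -/
theorem SeqSlitAvoidance_of_values (h5 : Registered.stub_slitUniformizer) (h4 : Registered.stub_farHullVanishAt)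
    (h6 : Registered.stub_collarOfValues) (h2 : Registered.stub_puncturedMarkov)
    (h3 : Registered.stub_collarBridge) (hC : RootedAvoidanceLimit) :
    Summit.CriticalPhenomena.SAWScalingLimit.Theses.SAWLoopFugacityFlow.SeqSlitAvoidance :=
  SeqSlitAvoidance_of (h6 h5 h4 hC) h2 h3

/-- Wiring check (value-free path): the child from the registered stubs. -/
theorem SeqSlitAvoidance_proof :
    Summit.CriticalPhenomena.SAWScalingLimit.Theses.SAWLoopFugacityFlow.SeqSlitAvoidance :=
  SeqSlitAvoidance_of stub_slitCollarAvoidance stub_puncturedMarkov stub_collarBridge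

/-- Wiring check (value path): the child from p1's C⁺ and the registered stubs. -/
theorem SeqSlitAvoidance_proof_values (hC : RootedAvoidanceLimit) :
    Summit.CriticalPhenomena.SAWScalingLimit.Theses.SAWLoopFugacityFlow.SeqSlitAvoidance :=
  SeqSlitAvoidance_of_values stub_slitUniformizer stub_farHullVanishAt stub_collarOfValues
    stub_puncturedMarkov stub_collarBridge hC

/-! ## The same child on route SAWStressTensor (item stmt-CriticalPhenomena-18398, ARC split of stmt-4514, rev 4) -/

/-- The child decl of route SAWStressTensor IS `Transfer.SequentialSlitAvoidance` (definitional). [folklore] -/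
theorem childST_iff :
    Summit.CriticalPhenomena.SAWScalingLimit.Theses.SAWStressTensor.SeqSlitAvoidance ↔
      SequentialSlitAvoidance :=
  Iff.rfl

/-- **COMPOSITION for stmt-CriticalPhenomena-18398** (value-free path), BY NAME. [folklore] -/
theorem SeqSlitAvoidanceST_of (h1 : Registered.stub_slitCollarAvoidance) (h2 : Registered.stub_puncturedMarkov)
    (h3 : Registered.stub_collarBridge) :
    Summit.CriticalPhenomena.SAWScalingLimit.Theses.SAWStressTensor.SeqSlitAvoidance :=
  childST_iff.2 (h3 h2 h1)

/-- Wiring check for stmt-18398: the child from the registered stubs. -/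
theorem SeqSlitAvoidanceST_proof :
    Summit.CriticalPhenomena.SAWScalingLimit.Theses.SAWStressTensor.SeqSlitAvoidance :=
  SeqSlitAvoidanceST_of stub_slitCollarAvoidance stub_puncturedMarkov stub_collarBridge

end Summit.CriticalPhenomena.SAWScalingLimit.Cruxes.SimpleSubseqLimits.SeqSlitBirth

end
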